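import Literature.AlgebraicGeometry.HodgeTheory.AlgebraicClassesGysinOneSpan
import Literature.AlgebraicGeometry.HodgeTheory.ComplexOrientationFamily
import Literature.AlgebraicGeometry.HodgeTheory.NodalDivisor
import Literature.AlgebraicGeometry.Motives.CartierDivisorOfIdealSheaf
import HarnessLib

/-!
# Smoothing middle-dimensional cycles (Kleiman) and nodal hypersurfaces through a smooth subvariety
# (Thomas, after Altman–Kleiman) — the sixfold case, as used in Thomas's "Nodes and the Hodge conjecture"

Family `hodge`, layer `Literature/AlgebraicGeometry/HodgeTheory`. Two NAMED FACTS (statement only, no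
proof, D-0014), both from §4 "Only if" of R. P. Thomas, *Nodes and the Hodge conjecture*, J. Algebraic
Geom. 14 (2005) 177–185 = arXiv:math/0212216 (held text read, PDF p. 6), where Thomas shows that an
algebraic middle-dimensional class of a smooth projective `2n`-fold is carried by a NODAL hypersurface:

> **Theorem 5 [Kl].** Let `Z^k ⊂ X^d` be an effective cycle of dimension `k ≤ (d+1)/2` in a smooth
> projective `d`-fold `X`. Then `(d-k-1)![Z] + N H^{∩(d-k)}` is algebraically equivalent to a smooth cycle
> for `N ≫ 0`. (Kleiman, *Geometry on Grassmannians and applications to splitting bundles and smoothing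
> cycles*, Publ. Math. IHÉS 36 (1969) 281–297.)
>
> **Theorem 6.** Let `Zⁿ ⊂ X²ⁿ` be a smooth subvariety. For `N ≫ 0`, `Z` is contained in hypersurfaces
> `D` in `|NH|` whose only singularities are ODPs on `Z`. (Proof there: the general section of `𝓘_Z(N)` is
> smooth off `Z` and has ordinary double points exactly at the simple zeros of the induced section of
> `ν_Z^*(N)`; "an easier form … due to Altman and Kleiman [AK]", Comm. Algebra 7 (1979) 775–790.)

Consumer: route `HodgeConjecture/NodalThetaWeil`, crux `NodeDualClassesAlgebraic` (stmt-7745), the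
nodal-boundary line (`Summits/…/Theorems/NodalThetaWeilNodeDualClassesAlgebraic*`), which proves
`WeilSixfolds ↔` "one smooth projective threefold `g : V ⟶ A` per balanced Weil sixfold whose class is
off the mixed `K`-eigenclass span" and uses these two facts to show that the route's nodal-theta
LOCATION of that threefold is automatic. Only the case `d = 2n = 6`, `k = n = 3` is typed.

## What is recorded (faithfulness)

* `Kleiman1969_algebraicClasses_le_span_smoothThreefolds` — Thm. 5 for `(d, k) = (6, 3)`, on the
  carriers and IN COHOMOLOGY: every class of `N³H⁶(X(ℂ); ℂ) = algebraicClasses X 3` (which is the span of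
  the Gysin images `g_* 1_V` of smooth projective threefolds `g : V ⟶ X`, the tree's
  `algebraicClasses_eq_span_complexGysin_one`, i.e. of the classes of effective `3`-cycles) is a
  `ℂ`-combination of the classes `j_* 1_Z` of smooth CLOSED threefolds `j : Z ↪ X`. This is Thm. 5 read
  in cohomology (`∼_alg` implies `∼_hom`) together with the classical remark that `H^{∩3}` is itself the
  class of a smooth complete intersection of three general hyperplane sections (Bertini), i.e. Kleiman's
  theorem in its usual form "`CH₃(X)_ℚ` is generated by smooth subvarieties for `3 < (6+2)/2`". WEAKER
  than print (cohomology classes, `ℂ`-span), never stronger.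
* `Thomas2005_smoothThreefold_in_nodalMember` — Thm. 6 for `n = 3`, with the very ample `H` replaced by
  the multiples of an arbitrary AMPLE Cartier divisor `Θ` (apply Thm. 6 to the embedding given by a very
  ample multiple `k₁Θ`; `D ∈ |N k₁ Θ|`): for every `k₀` there are `k ≥ k₀`, a `k`-fold member `D` of
  `|Θ|`-multiples — a closed subscheme `ι : D ↪ X` whose ideal is effective Cartier and linearly
  equivalent to `kΘ` (`CartierDivisor.ofIsEffectiveCartier … |>.LinEquiv (k • Θ)`) — which is a NODAL
  DIVISOR (`IsNodalDivisor 5 m ι`: reduced, exactly `m` singular points, all ordinary double points) and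
  contains `Z` (`h ≫ ι = j`) with all its singular points on `Z`. "For `N ≫ 0`" is rendered "for every
  `k₀` some `k ≥ k₀`" (weaker). The number of nodes `m = c₃(ν_Z^*(k))` is not asserted positive.
* The converse inclusion of the first fact — each `j_* 1_Z` is algebraic — is the tree's
  `complexGysin_one_mem_algebraicClasses_codim` (proved Summit-side next to the consumer), so the fact
  is in substance an equality. This file is STATEMENT-ONLY.

## References

* [Thomas2005Nodes] R. P. Thomas, Nodes and the Hodge conjecture, J. Algebraic Geom. 14 (2005), §4,
  Theorems 5 and 6 (arXiv:math/0212216, p. 6).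
* [Kleiman1969Grassmannians] S. L. Kleiman, Geometry on Grassmannians and applications to splitting
  bundles and smoothing cycles, Publ. Math. IHÉS 36 (1969) 281–297.
* A. Altman, S. Kleiman, Bertini theorems for hypersurface sections containing a subscheme, Comm.
  Algebra 7 (1979) 775–790.
-/

noncomputable section

open CategoryTheory AlgebraicGeometry

namespace Literature.AlgebraicGeometry.HodgeTheory

section HodgeTheory

open Literature.AlgebraicTopology.SingularHomology

/-- **Kleiman's smoothing theorem in the middle dimension of a sixfold (Thomas 2005, Thm. 5 [Kl]), in
cohomology.** For a smooth projective complex sixfold `X`, every algebraic class of codimension `3` —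
every element of `N³H⁶(X(ℂ); ℂ) = algebraicClasses X 3`, the span of the classes of effective `3`-cycles
— is a `ℂ`-linear combination of the classes `j_* 1_Z` of smooth CLOSED threefolds `j : Z ↪ X`
("`2[Z] + N H^{∩3}` is algebraically equivalent to a smooth cycle for `N ≫ 0`", and `H^{∩3}` is the
class of a smooth linear section). A NAMED FACT (unproved in the tree).
[cite: Thomas2005Nodes, Thm. 5] [cite: Kleiman1969Grassmannians, smoothing theorem] -/
def Kleiman1969_algebraicClasses_le_span_smoothThreefolds : Prop :=
  ∀ (X : Motives.SchemeOver ℂ) (hX : Motives.IsSmoothProjective (2 * 3) X),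
    algebraicClasses X 3 ≤ Submodule.span ℂ
      {c : complexBetti X (2 * 3) | ∃ (Z : Motives.SchemeOver ℂ) (hZ : Motives.IsSmoothProjective 3 Z)
        (j : Z ⟶ X), IsClosedImmersion j.left ∧
          c = complexGysin complexOrientationFamily hZ hX j (rfl : 0 + 2 * (2 * 3) = 2 * 3 + 2 * 3)
            (singularCohomology.one ℂ (Motives.ComplexPoints Z))}
-- TODO(general form): `CH_i(X)_ℚ` is generated by smooth closed subvarieties for every smooth
-- projective `X` and every `i < (dim X + 2)/2` (Kleiman 1969); here only `(dim X, i) = (6, 3)`.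

/-- **A smooth closed threefold of a smooth projective sixfold lies on nodal members of every high
multiple of an ample divisor, with the nodes on it (Thomas 2005, Thm. 6; Altman–Kleiman).** For `X`
smooth projective of dimension `6` over `ℂ`, `Θ` an ample Cartier divisor, `j : Z ↪ X` a smooth closed
threefold and every `k₀`: there are `k ≥ k₀` and a closed subscheme `ι : D ↪ X` whose ideal is an
effective Cartier divisor linearly equivalent to `kΘ`, which is a nodal divisor — reduced, with exactly
`m` singular points, all ordinary double points (`IsNodalDivisor 5 m ι`) — containing `Z`
(`h ≫ ι = j`), every singular point of `D` lying on `Z` ("whose only singularities are ODPs on `Z`").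
A NAMED FACT (unproved in the tree). [cite: Thomas2005Nodes, Thm. 6] -/
def Thomas2005_smoothThreefold_in_nodalMember : Prop :=
  ∀ (X : Motives.SchemeOver ℂ) (_hX : Motives.IsSmoothProjective (2 * 3) X) [IsIntegral X.left]
    (Θ : Motives.CartierDivisor X.left), Θ.IsAmple →
    ∀ (Z : Motives.SchemeOver ℂ) (_hZ : Motives.IsSmoothProjective 3 Z) (j : Z ⟶ X),
      IsClosedImmersion j.left →
    ∀ k₀ : ℕ, ∃ (k m : ℕ) (D : Motives.SchemeOver ℂ) (ι : D ⟶ X) (h : Z ⟶ D),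
      k₀ ≤ k ∧ IsNodalDivisor 5 m ι ∧
      (∃ hI : Resolution.IsEffectiveCartier ι.left.ker,
        (Motives.CartierDivisor.ofIsEffectiveCartier ι.left.ker hI).LinEquiv (k • Θ)) ∧
      h ≫ ι = j ∧
      ∀ x : D.left, ¬ IsRegularLocalRing (D.left.presheaf.stalk x) → x ∈ Set.range h.left.base
-- TODO(general form): `Zⁿ ⊂ X²ⁿ` smooth for every `n ≥ 1`, `H` very ample, ALL `N ≫ 0`; the number of
-- nodes is `c_n(ν_Z^*(N))` (positive for `N ≫ 0`).

end HodgeTheory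

end Literature.AlgebraicGeometry.HodgeTheory

end
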